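import Summits.HodgeConjecture.CorCM.MultiFieldWeilTwoPerIsolatedFieldFamilies
import Summits.HodgeConjecture.CorCM.CMAbelianFactorsDimLeThreeClassification
import Summits.HodgeConjecture.CorCM.MultiFieldWeilSeparatedThreefoldFactorsWitnessed
import HarnessLib

/-!
# MULTI-FIELD WEIL ENGINE — ON THE VARIETY, TWO CLASSES PER ISOLATED FIELD: a complex abelian variety of CM type with simple isogeny factors of dimension `≤ 3` in which a sextic CM
# field WITH an imaginary quadratic subfield may carry TWO isogeny classes of threefold factors provided it is ISOLATED (no other threefold factor's field shares its imaginary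
# quadratic subfield or its Galois closure), at most three classes per field, no dihedral surface triple — the Hodge conjecture for everything dominated by its powers, given
# ONLY Markman's fourfold theorem

Cell `pub-hodgecm2` (COR-CM), seat b30 gen 37 (2026-08-25); count-neutral own lane MULTI-FIELD WEIL ENGINE (stem `MultiFieldWeil*`) — `CorCM/MultiFieldWeilTwoPerIsolatedFieldFamilies.lean`
read on the variety through Milne's regrouping, in the pattern of `CorCM/MultiFieldWeilClassesPerFieldFactors.lean` whose hypothesis (b₁) «at most ONE isogeny class of threefold factors per
sextic CM field with an imaginary quadratic subfield» is RELAXED here to (b₂); §2 the WITNESSED form of (b₂).  Theorems only; no definition, no named fact, no `sorry`.  HONEST FRAMING: conditional on the displayed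
Markman fourfold binder only; `HC_CM` is NOT proved and not asserted — a statement about a NAMED CLASS of CM abelian varieties.

THE STATEMENT (**`hodgeConjectureFor_of_avDominatedBy_powSucc_of_isOfCMType_of_twoPerIsolatedField_of_markman`**).  Let `X` be a complex abelian variety of CM type such that
(a) every simple isogeny factor has dimension `≤ 3`; (b₂) for any two NON-isogenous simple threefold factors `B₀ ⊨ (K₀; Φ₀)`, `B₁ ⊨ (K₁; Φ₁)` (all CM realisations) such that a
totally complex quadratic subfield of `K₀` embeds in `K₁`: EITHER `K₁ ≄ K₀`, OR the pair is ISOLATED — for every simple threefold factor `B₂ ⊨ (K₂; Φ₂)` isogenous to neither, no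
totally complex quadratic subfield of `K₀` embeds in `K₂` and the Galois closures of `K₂`, `K₀` in `ℂ` differ (so a field `k·F⁺` may carry TWO classes when no third threefold
factor lives over `k` or inside `k·L(F⁺)`); (b₃) no FOUR pairwise non-isogenous simple threefold factors have pairwise isomorphic CM fields; (c) no three pairwise non-isogenous
simple surface factors have CM fields sharing one Galois closure.  Then EVERY complex abelian variety dominated by a power `X^{N+1}` satisfies the Hodge conjecture, GIVEN ONLY
`Markman2025_weilClasses_algebraic_abelianFourfold`.  HONEST LIMITS: two classes of `k·F⁺` together with a third threefold factor over `k` or inside `k·L(F⁺)` (e.g. over the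
sister field `k′·F⁺`); three classes of one `k·F⁺`; four classes of one field; the dihedral surface triple; simple factors of dimension `≥ 4`.

[cite: MoonenZarhin1999LowDim, Thm. (0.1), Thm. (0.2), §3 (3.1), Cor. (3.9), §5 (5.2)] [cite: Markman2025SurveySecant, Thm. 1.2] [cite: Milne1999LefschetzClasses, §1 Prop. 1.1]
[cite: MilneCM2006, Ch. I Prop. 3.13] [cite: Dodson1984, §5.1.2 Theorem] [cite: MumfordAV1970, §19 Thm. 1, Cor. 1–2 and p. 169] [cite: Lang2002, I §6 Thm. 6.4 (ii); VI §1 Thm. 1.1]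
-/

noncomputable section

open CategoryTheory CategoryTheory.Limits NumberField IntermediateField

namespace Summit.HodgeConjecture.CorCM.MultiFieldWeil

open Literature.AlgebraicGeometry Literature.AlgebraicGeometry.Motives Literature.AlgebraicGeometry.HodgeTheory
open Literature.AlgebraicGeometry.Motives.AbelianVariety
open Literature.AlgebraicGeometry.ComplexMultiplication (IsCMTypeRealisation exists_ringEquiv_forall_mem_iff_of_isIsogenous)
open Literature.AlgebraicTopology.SingularHomology
open Literature.NumberTheory.ComplexMultiplication
open Literature.AlgebraicGeometry.Milne1999 (IsOfCMType)
open Summit.HodgeConjecture.CorCM.Domination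

open scoped Classical

section OnTheVariety

variable {X : AbelianVariety ℂ}

/-- Powers of a zero-dimensional abelian variety are zero-dimensional. [folklore] -/
private theorem dim_powSucc_eq_zero₃₇e (h0 : X.dim = 0) : ∀ N : ℕ, (X.powSucc N).dim = 0
  | 0 => h0
  | N + 1 => by rw [powSucc_succ, dim_prod, dim_powSucc_eq_zero₃₇e h0 N, h0]

/-- **MAIN THEOREM (on the variety) — TWO CLASSES PER ISOLATED HAS-k FIELD, THREE PER FIELD, NO DIHEDRAL SURFACE TRIPLE, ANY ELLIPTIC FACTORS — given ONLY Markman's fourfold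
theorem.**  `X` of CM type; (a) simple isogeny factors of dimension `≤ 3`; (b₂) for any two non-isogenous simple threefold factors and all CM realisations `B₀ ⊨ (K₀; Φ₀)`,
`B₁ ⊨ (K₁; Φ₁)` with a totally complex quadratic `F ≤ K₀` embedding in `K₁`: `K₁ ≄ K₀`, OR for every simple threefold factor `B₂ ⊨ (K₂; Φ₂)` isogenous to neither no totally complex
quadratic subfield of `K₀` embeds in `K₂` and `L(K₂) ≠ L(K₀)`; (b₃) no four pairwise non-isogenous simple threefold factors with pairwise isomorphic CM fields; (c) no three pairwise
non-isogenous simple surface factors with CM realisations sharing one Galois closure.  Then everything dominated by a power `X^{N+1}` satisfies the Hodge conjecture, GIVEN ONLY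
`Markman2025_weilClasses_algebraic_abelianFourfold`.  `HC_CM` is NOT asserted. [cite: Milne1999LefschetzClasses, §1 Prop. 1.1] [cite: MoonenZarhin1999LowDim, Thm. (0.1), (0.2), §3 (3.1), Cor. (3.9)]
[cite: Markman2025SurveySecant, Thm. 1.2] [cite: Dodson1984, §5.1.2 Theorem] [cite: MumfordAV1970, §19 Thm. 1, Cor. 1–2] [cite: Lang2002, I §6 Thm. 6.4 (ii); VI §1 Thm. 1.1] -/
theorem hodgeConjectureFor_of_avDominatedBy_powSucc_of_isOfCMType_of_twoPerIsolatedField_of_markman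
    (hW4 : Markman2025_weilClasses_algebraic_abelianFourfold) (hcm : IsOfCMType X)
    (h3 : ∀ B : AbelianVariety ℂ, B.IsSimple → AVDominatedBy B X → B.dim ≤ 3)
    (hT : ∀ B₀ B₁ : AbelianVariety ℂ, B₀.IsSimple → B₁.IsSimple → AVDominatedBy B₀ X → AVDominatedBy B₁ X → B₀.dim = 3 → B₁.dim = 3 → ¬ IsIsogenous B₀ B₁ →
      ∀ (K₀ : Type) [Field K₀] [NumberField K₀] [IsCMField K₀] (Φ₀ : CMType K₀) (ι₀ : 𝓞 K₀ →+* End B₀) (θ₀ : K₀ →+* Module.End ℂ (complexBetti B₀.X 1))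
        (K₁ : Type) [Field K₁] [NumberField K₁] [IsCMField K₁] (Φ₁ : CMType K₁) (ι₁ : 𝓞 K₁ →+* End B₁) (θ₁ : K₁ →+* Module.End ℂ (complexBetti B₁.X 1)),
        IsCMTypeRealisation Φ₀ B₀ ι₀ θ₀ → IsCMTypeRealisation Φ₁ B₁ ι₁ θ₁ →
          (∃ F : IntermediateField ℚ K₀, Module.finrank ℚ F = 2 ∧ IsTotallyComplex F ∧ Nonempty (F →+* K₁)) → IsEmpty (K₁ ≃+* K₀) ∨
            ∀ B₂ : AbelianVariety ℂ, B₂.IsSimple → AVDominatedBy B₂ X → B₂.dim = 3 → ¬ IsIsogenous B₂ B₀ → ¬ IsIsogenous B₂ B₁ →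
              ∀ (K₂ : Type) [Field K₂] [NumberField K₂] [IsCMField K₂] (Φ₂ : CMType K₂) (ι₂ : 𝓞 K₂ →+* End B₂) (θ₂ : K₂ →+* Module.End ℂ (complexBetti B₂.X 1)),
                IsCMTypeRealisation Φ₂ B₂ ι₂ θ₂ →
                  (¬ ∃ F : IntermediateField ℚ K₀, Module.finrank ℚ F = 2 ∧ IsTotallyComplex F ∧ Nonempty (F →+* K₂)) ∧ normalClosure ℚ K₂ ℂ ≠ normalClosure ℚ K₀ ℂ)
    (hT4 : ∀ B₀ B₁ B₂ B₃ : AbelianVariety ℂ, B₀.IsSimple → B₁.IsSimple → B₂.IsSimple → B₃.IsSimple →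
      AVDominatedBy B₀ X → AVDominatedBy B₁ X → AVDominatedBy B₂ X → AVDominatedBy B₃ X → B₀.dim = 3 → B₁.dim = 3 → B₂.dim = 3 → B₃.dim = 3 →
      ¬ IsIsogenous B₀ B₁ → ¬ IsIsogenous B₀ B₂ → ¬ IsIsogenous B₀ B₃ → ¬ IsIsogenous B₁ B₂ → ¬ IsIsogenous B₁ B₃ → ¬ IsIsogenous B₂ B₃ →
      ∀ (K₀ : Type) [Field K₀] [NumberField K₀] [IsCMField K₀] (Φ₀ : CMType K₀) (ι₀ : 𝓞 K₀ →+* End B₀) (θ₀ : K₀ →+* Module.End ℂ (complexBetti B₀.X 1))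
        (K₁ : Type) [Field K₁] [NumberField K₁] [IsCMField K₁] (Φ₁ : CMType K₁) (ι₁ : 𝓞 K₁ →+* End B₁) (θ₁ : K₁ →+* Module.End ℂ (complexBetti B₁.X 1))
        (K₂ : Type) [Field K₂] [NumberField K₂] [IsCMField K₂] (Φ₂ : CMType K₂) (ι₂ : 𝓞 K₂ →+* End B₂) (θ₂ : K₂ →+* Module.End ℂ (complexBetti B₂.X 1))
        (K₃ : Type) [Field K₃] [NumberField K₃] [IsCMField K₃] (Φ₃ : CMType K₃) (ι₃ : 𝓞 K₃ →+* End B₃) (θ₃ : K₃ →+* Module.End ℂ (complexBetti B₃.X 1)),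
        IsCMTypeRealisation Φ₀ B₀ ι₀ θ₀ → IsCMTypeRealisation Φ₁ B₁ ι₁ θ₁ → IsCMTypeRealisation Φ₂ B₂ ι₂ θ₂ → IsCMTypeRealisation Φ₃ B₃ ι₃ θ₃ →
          ¬ (Nonempty (K₁ ≃+* K₀) ∧ Nonempty (K₂ ≃+* K₀) ∧ Nonempty (K₃ ≃+* K₀)))
    (hS : ∀ B₀ B₁ B₂ : AbelianVariety ℂ, B₀.IsSimple → B₁.IsSimple → B₂.IsSimple → AVDominatedBy B₀ X → AVDominatedBy B₁ X → AVDominatedBy B₂ X →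
      B₀.dim = 2 → B₁.dim = 2 → B₂.dim = 2 → ¬ IsIsogenous B₀ B₁ → ¬ IsIsogenous B₀ B₂ → ¬ IsIsogenous B₁ B₂ →
      ∀ (K₀ : Type) [Field K₀] [NumberField K₀] [IsCMField K₀] (Φ₀ : CMType K₀) (ι₀ : 𝓞 K₀ →+* End B₀) (θ₀ : K₀ →+* Module.End ℂ (complexBetti B₀.X 1))
        (K₁ : Type) [Field K₁] [NumberField K₁] [IsCMField K₁] (Φ₁ : CMType K₁) (ι₁ : 𝓞 K₁ →+* End B₁) (θ₁ : K₁ →+* Module.End ℂ (complexBetti B₁.X 1))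
        (K₂ : Type) [Field K₂] [NumberField K₂] [IsCMField K₂] (Φ₂ : CMType K₂) (ι₂ : 𝓞 K₂ →+* End B₂) (θ₂ : K₂ →+* Module.End ℂ (complexBetti B₂.X 1)),
        IsCMTypeRealisation Φ₀ B₀ ι₀ θ₀ → IsCMTypeRealisation Φ₁ B₁ ι₁ θ₁ → IsCMTypeRealisation Φ₂ B₂ ι₂ θ₂ →
          ¬ (normalClosure ℚ K₀ ℂ = normalClosure ℚ K₁ ℂ ∧ normalClosure ℚ K₁ ℂ = normalClosure ℚ K₂ ℂ))
    {B : AbelianVariety ℂ} {N : ℕ} (hB : AVDominatedBy B (X.powSucc N)) : HodgeConjectureFor B.dim B.X := by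
  rcases Nat.eq_zero_or_pos X.dim with h0 | hX0
  · exact hodgeConjectureFor_of_isDivisorGenerated _ (isDivisorGenerated_of_avDominatedBy hB
      (Literature.AlgebraicGeometry.Pohlmann1968.isDivisorGenerated_of_dim_eq_zero _ (dim_powSucc_eq_zero₃₇e h0 N)))
  -- Milne's regrouping: `X ∼ ⨁_i A'_{cls i}`, `A'_c` simple, pairwise non-isogenous, CM-realised
  obtain ⟨C, _, K', _, _, _, Φ', A', ι', θ', m, cls, f, hA, hs, hniso, hcls, hf⟩ := exists_isIsogeny_biproduct_of_isSimple_of_isOfCMType (X := X) hX0 hcm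
  have hXP : AVDominatedBy X (⨁ fun i => A' (cls i)) := AVDominatedBy.of_isIsogeny_hom hf (AVDominatedBy.refl _)
  have hPX : AVDominatedBy (⨁ fun i => A' (cls i)) X := AVDominatedBy.of_isIsogeny_inv hf (AVDominatedBy.refl _)
  have hslot : ∀ c, AVDominatedBy (A' c) X := fun c => by
    obtain ⟨i, rfl⟩ := hcls c
    exact (avDominatedBy_biproduct_summand (fun i => A' (cls i)) i).trans hPX
  have hdim3 : ∀ c, (A' c).dim ≤ 3 := fun c => h3 _ (hs c) (hslot c)
  have hfin : ∀ c, Module.finrank ℚ (K' c) = 2 * (A' c).dim := fun c =>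
    Literature.AlgebraicGeometry.Pohlmann1968.finrank_eq_two_mul_dim_of_isCMTypeRealisation (hA c)
  -- (b₂) on the sextic slots: sharing forces non-isomorphic fields, unless isolated
  have hQ : ∀ t t' : C, t ≠ t' → Module.finrank ℚ (K' t) = 6 → Module.finrank ℚ (K' t') = 6 →
      (∃ F : IntermediateField ℚ (K' t), Module.finrank ℚ F = 2 ∧ IsTotallyComplex F ∧ Nonempty (F →+* K' t')) → IsEmpty (K' t' ≃+* K' t) ∨
        ∀ t'' : C, Module.finrank ℚ (K' t'') = 6 → t'' ≠ t → t'' ≠ t' →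
          (¬ ∃ F : IntermediateField ℚ (K' t), Module.finrank ℚ F = 2 ∧ IsTotallyComplex F ∧ Nonempty (F →+* K' t'')) ∧
            normalClosure ℚ (K' t'') ℂ ≠ normalClosure ℚ (K' t) ℂ := by
    intro t t' hne ht ht' hsh
    refine (hT (A' t) (A' t') (hs t) (hs t') (hslot t) (hslot t') (by have := hfin t; omega) (by have := hfin t'; omega) (hniso t t' hne)
      (K' t) (Φ' t) (ι' t) (θ' t) (K' t') (Φ' t') (ι' t') (θ' t') (hA t) (hA t') hsh).imp_right fun hisol t'' ht'' h₁ h₂ => ?_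
    exact hisol (A' t'') (hs t'') (hslot t'') (by have := hfin t''; omega) (hniso t'' t h₁) (hniso t'' t' h₂) (K' t'') (Φ' t'') (ι' t'') (θ' t'') (hA t'')
  -- pairwise non-isogeny of the slots, and (b″) at most three per isomorphism class
  have hN : ∀ t t' : C, t ≠ t' → Module.finrank ℚ (K' t) = 6 → Module.finrank ℚ (K' t') = 6 → ¬ IsIsogenous (A' t) (A' t') := fun t t' h _ _ => hniso t t' h
  have hB3 : ∀ t : C, Module.finrank ℚ (K' t) = 6 → (Finset.univ.filter fun t' => Nonempty (K' t' ≃+* K' t)).card ≤ 3 := by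
    intro t ht
    by_contra hlt
    push Not at hlt
    obtain ⟨d, hd, hdm⟩ := exists_injective_fin_of_le_card (s := Finset.univ.filter fun t' => Nonempty (K' t' ≃+* K' t)) (n := 4) hlt
    have hiso : ∀ x, Nonempty (K' (d x) ≃+* K' t) := fun x => (Finset.mem_filter.1 (hdm x)).2
    have h6d : ∀ x, Module.finrank ℚ (K' (d x)) = 6 := fun x => by
      obtain ⟨e⟩ := hiso x
      rw [← ht]; exact (AlgEquiv.ofRingEquiv (f := e) fun q => map_ratCast e q).toLinearEquiv.finrank_eq
    have hne : ∀ x y : Fin 4, x ≠ y → d x ≠ d y := fun x y h h' => h (hd h')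
    have hcomp : ∀ x, Nonempty (K' (d x) ≃+* K' (d 0)) := fun x => by
      obtain ⟨e⟩ := hiso x; obtain ⟨e₀⟩ := hiso 0; exact ⟨e.trans e₀.symm⟩
    exact hT4 (A' (d 0)) (A' (d 1)) (A' (d 2)) (A' (d 3)) (hs _) (hs _) (hs _) (hs _) (hslot _) (hslot _) (hslot _) (hslot _)
      (by have := hfin (d 0); have := h6d 0; omega) (by have := hfin (d 1); have := h6d 1; omega) (by have := hfin (d 2); have := h6d 2; omega)
      (by have := hfin (d 3); have := h6d 3; omega)
      (hniso _ _ (hne 0 1 (by decide))) (hniso _ _ (hne 0 2 (by decide))) (hniso _ _ (hne 0 3 (by decide))) (hniso _ _ (hne 1 2 (by decide)))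
      (hniso _ _ (hne 1 3 (by decide))) (hniso _ _ (hne 2 3 (by decide)))
      (K' (d 0)) (Φ' (d 0)) (ι' (d 0)) (θ' (d 0)) (K' (d 1)) (Φ' (d 1)) (ι' (d 1)) (θ' (d 1)) (K' (d 2)) (Φ' (d 2)) (ι' (d 2)) (θ' (d 2)) (K' (d 3)) (Φ' (d 3)) (ι' (d 3)) (θ' (d 3))
      (hA _) (hA _) (hA _) (hA _) ⟨hcomp 1, hcomp 2, hcomp 3⟩
  -- (c) on the quartic slots
  have hS3 : ∀ i j l : C, Module.finrank ℚ (K' i) = 4 → Module.finrank ℚ (K' j) = 4 → Module.finrank ℚ (K' l) = 4 →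
      normalClosure ℚ (K' i) ℂ = normalClosure ℚ (K' j) ℂ → normalClosure ℚ (K' j) ℂ = normalClosure ℚ (K' l) ℂ →
      IsIsogenous (A' i) (A' j) ∨ IsIsogenous (A' i) (A' l) ∨ IsIsogenous (A' j) (A' l) := by
    intro i j l hi hj hl hLij hLjl
    by_cases hij : i = j
    · subst hij
      exact Or.inl (IsIsogenous.refl _)
    by_cases hil : i = l
    · subst hil
      exact Or.inr (Or.inl (IsIsogenous.refl _))
    by_cases hjl : j = l
    · subst hjl
      exact Or.inr (Or.inr (IsIsogenous.refl _))
    exact absurd ⟨hLij, hLjl⟩ (hS (A' i) (A' j) (A' l) (hs i) (hs j) (hs l) (hslot i) (hslot j) (hslot l) (by have := hfin i; omega)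
      (by have := hfin j; omega) (by have := hfin l; omega) (hniso i j hij) (hniso i l hil) (hniso j l hjl)
      (K' i) (Φ' i) (ι' i) (θ' i) (K' j) (Φ' j) (ι' j) (θ' j) (K' l) (Φ' l) (ι' l) (θ' l) (hA i) (hA j) (hA l))
  -- every power of `X` is dominated by a product of copies of the slots
  obtain ⟨n, π, hdom⟩ := exists_avDominatedBy_powSucc_biproduct_slots A' cls hXP N
  exact hodgeConjectureFor_of_avDominatedBy_prod_of_twoPerIsolatedField_of_markman (I := C) hW4 hA hs hdim3 hQ hN hB3 hS3 π (hB.trans hdom)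

/-- **The Hodge conjecture for `X` itself and all its powers**, under (a), (b₂), (b₃), (c), given only Markman's fourfold theorem. [cite: MoonenZarhin1999LowDim, Thm. (0.1), (0.2)]
[cite: Markman2025SurveySecant, Thm. 1.2] -/
theorem hodgeConjectureFor_powSucc_of_isOfCMType_of_twoPerIsolatedField_of_markman (hW4 : Markman2025_weilClasses_algebraic_abelianFourfold)
    (hcm : IsOfCMType X) (h3 : ∀ B : AbelianVariety ℂ, B.IsSimple → AVDominatedBy B X → B.dim ≤ 3)
    (hT : ∀ B₀ B₁ : AbelianVariety ℂ, B₀.IsSimple → B₁.IsSimple → AVDominatedBy B₀ X → AVDominatedBy B₁ X → B₀.dim = 3 → B₁.dim = 3 → ¬ IsIsogenous B₀ B₁ →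
      ∀ (K₀ : Type) [Field K₀] [NumberField K₀] [IsCMField K₀] (Φ₀ : CMType K₀) (ι₀ : 𝓞 K₀ →+* End B₀) (θ₀ : K₀ →+* Module.End ℂ (complexBetti B₀.X 1))
        (K₁ : Type) [Field K₁] [NumberField K₁] [IsCMField K₁] (Φ₁ : CMType K₁) (ι₁ : 𝓞 K₁ →+* End B₁) (θ₁ : K₁ →+* Module.End ℂ (complexBetti B₁.X 1)),
        IsCMTypeRealisation Φ₀ B₀ ι₀ θ₀ → IsCMTypeRealisation Φ₁ B₁ ι₁ θ₁ →
          (∃ F : IntermediateField ℚ K₀, Module.finrank ℚ F = 2 ∧ IsTotallyComplex F ∧ Nonempty (F →+* K₁)) → IsEmpty (K₁ ≃+* K₀) ∨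
            ∀ B₂ : AbelianVariety ℂ, B₂.IsSimple → AVDominatedBy B₂ X → B₂.dim = 3 → ¬ IsIsogenous B₂ B₀ → ¬ IsIsogenous B₂ B₁ →
              ∀ (K₂ : Type) [Field K₂] [NumberField K₂] [IsCMField K₂] (Φ₂ : CMType K₂) (ι₂ : 𝓞 K₂ →+* End B₂) (θ₂ : K₂ →+* Module.End ℂ (complexBetti B₂.X 1)),
                IsCMTypeRealisation Φ₂ B₂ ι₂ θ₂ →
                  (¬ ∃ F : IntermediateField ℚ K₀, Module.finrank ℚ F = 2 ∧ IsTotallyComplex F ∧ Nonempty (F →+* K₂)) ∧ normalClosure ℚ K₂ ℂ ≠ normalClosure ℚ K₀ ℂ)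
    (hT4 : ∀ B₀ B₁ B₂ B₃ : AbelianVariety ℂ, B₀.IsSimple → B₁.IsSimple → B₂.IsSimple → B₃.IsSimple →
      AVDominatedBy B₀ X → AVDominatedBy B₁ X → AVDominatedBy B₂ X → AVDominatedBy B₃ X → B₀.dim = 3 → B₁.dim = 3 → B₂.dim = 3 → B₃.dim = 3 →
      ¬ IsIsogenous B₀ B₁ → ¬ IsIsogenous B₀ B₂ → ¬ IsIsogenous B₀ B₃ → ¬ IsIsogenous B₁ B₂ → ¬ IsIsogenous B₁ B₃ → ¬ IsIsogenous B₂ B₃ →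
      ∀ (K₀ : Type) [Field K₀] [NumberField K₀] [IsCMField K₀] (Φ₀ : CMType K₀) (ι₀ : 𝓞 K₀ →+* End B₀) (θ₀ : K₀ →+* Module.End ℂ (complexBetti B₀.X 1))
        (K₁ : Type) [Field K₁] [NumberField K₁] [IsCMField K₁] (Φ₁ : CMType K₁) (ι₁ : 𝓞 K₁ →+* End B₁) (θ₁ : K₁ →+* Module.End ℂ (complexBetti B₁.X 1))
        (K₂ : Type) [Field K₂] [NumberField K₂] [IsCMField K₂] (Φ₂ : CMType K₂) (ι₂ : 𝓞 K₂ →+* End B₂) (θ₂ : K₂ →+* Module.End ℂ (complexBetti B₂.X 1))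
        (K₃ : Type) [Field K₃] [NumberField K₃] [IsCMField K₃] (Φ₃ : CMType K₃) (ι₃ : 𝓞 K₃ →+* End B₃) (θ₃ : K₃ →+* Module.End ℂ (complexBetti B₃.X 1)),
        IsCMTypeRealisation Φ₀ B₀ ι₀ θ₀ → IsCMTypeRealisation Φ₁ B₁ ι₁ θ₁ → IsCMTypeRealisation Φ₂ B₂ ι₂ θ₂ → IsCMTypeRealisation Φ₃ B₃ ι₃ θ₃ →
          ¬ (Nonempty (K₁ ≃+* K₀) ∧ Nonempty (K₂ ≃+* K₀) ∧ Nonempty (K₃ ≃+* K₀)))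
    (hS : ∀ B₀ B₁ B₂ : AbelianVariety ℂ, B₀.IsSimple → B₁.IsSimple → B₂.IsSimple → AVDominatedBy B₀ X → AVDominatedBy B₁ X → AVDominatedBy B₂ X →
      B₀.dim = 2 → B₁.dim = 2 → B₂.dim = 2 → ¬ IsIsogenous B₀ B₁ → ¬ IsIsogenous B₀ B₂ → ¬ IsIsogenous B₁ B₂ →
      ∀ (K₀ : Type) [Field K₀] [NumberField K₀] [IsCMField K₀] (Φ₀ : CMType K₀) (ι₀ : 𝓞 K₀ →+* End B₀) (θ₀ : K₀ →+* Module.End ℂ (complexBetti B₀.X 1))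
        (K₁ : Type) [Field K₁] [NumberField K₁] [IsCMField K₁] (Φ₁ : CMType K₁) (ι₁ : 𝓞 K₁ →+* End B₁) (θ₁ : K₁ →+* Module.End ℂ (complexBetti B₁.X 1))
        (K₂ : Type) [Field K₂] [NumberField K₂] [IsCMField K₂] (Φ₂ : CMType K₂) (ι₂ : 𝓞 K₂ →+* End B₂) (θ₂ : K₂ →+* Module.End ℂ (complexBetti B₂.X 1)),
        IsCMTypeRealisation Φ₀ B₀ ι₀ θ₀ → IsCMTypeRealisation Φ₁ B₁ ι₁ θ₁ → IsCMTypeRealisation Φ₂ B₂ ι₂ θ₂ →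
          ¬ (normalClosure ℚ K₀ ℂ = normalClosure ℚ K₁ ℂ ∧ normalClosure ℚ K₁ ℂ = normalClosure ℚ K₂ ℂ))
    (N : ℕ) : HodgeConjectureFor (X.powSucc N).dim (X.powSucc N).X :=
  hodgeConjectureFor_of_avDominatedBy_powSucc_of_isOfCMType_of_twoPerIsolatedField_of_markman hW4 hcm h3 hT hT4 hS (AVDominatedBy.refl _)


/-! ## §2 The witnessed form of (b₂): checked on one CM realisation of the pair -/

/-- **(b₂) WITNESSED.**  As the main theorem, but (b₂) is asked for ONE pair of CM realisations of each pair of non-isogenous simple threefold factors (the isolation clause still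
for all realisations of the third factor): the CM field of a simple CM abelian variety is unique up to isomorphism, and sharing, non-isomorphy and Galois closures transport along
field isomorphisms. [cite: MilneCM2006, Ch. I Prop. 3.13] [cite: Milne1999LefschetzClasses, §1 Prop. 1.1] [cite: MoonenZarhin1999LowDim, Thm. (0.1), (0.2), §3 (3.1), Cor. (3.9)]
[cite: Markman2025SurveySecant, Thm. 1.2] [cite: Lang2002, VI §1 Thm. 1.1 and Cor. 1.6] -/
theorem hodgeConjectureFor_of_avDominatedBy_powSucc_of_isOfCMType_of_witnessed_twoPerIsolatedField_of_markman
    (hW4 : Markman2025_weilClasses_algebraic_abelianFourfold) (hcm : IsOfCMType X)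
    (h3 : ∀ B : AbelianVariety ℂ, B.IsSimple → AVDominatedBy B X → B.dim ≤ 3)
    (hT : ∀ B₀ B₁ : AbelianVariety ℂ, B₀.IsSimple → B₁.IsSimple → AVDominatedBy B₀ X → AVDominatedBy B₁ X → B₀.dim = 3 → B₁.dim = 3 → ¬ IsIsogenous B₀ B₁ →
      ∃ (K₀ : Type) (_ : Field K₀) (_ : NumberField K₀) (_ : IsCMField K₀) (Φ₀ : CMType K₀) (ι₀ : 𝓞 K₀ →+* End B₀) (θ₀ : K₀ →+* Module.End ℂ (complexBetti B₀.X 1))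
        (K₁ : Type) (_ : Field K₁) (_ : NumberField K₁) (_ : IsCMField K₁) (Φ₁ : CMType K₁) (ι₁ : 𝓞 K₁ →+* End B₁) (θ₁ : K₁ →+* Module.End ℂ (complexBetti B₁.X 1)),
        IsCMTypeRealisation Φ₀ B₀ ι₀ θ₀ ∧ IsCMTypeRealisation Φ₁ B₁ ι₁ θ₁ ∧
          ((∃ F : IntermediateField ℚ K₀, Module.finrank ℚ F = 2 ∧ IsTotallyComplex F ∧ Nonempty (F →+* K₁)) → IsEmpty (K₁ ≃+* K₀) ∨
            ∀ B₂ : AbelianVariety ℂ, B₂.IsSimple → AVDominatedBy B₂ X → B₂.dim = 3 → ¬ IsIsogenous B₂ B₀ → ¬ IsIsogenous B₂ B₁ →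
              ∀ (K₂ : Type) [Field K₂] [NumberField K₂] [IsCMField K₂] (Φ₂ : CMType K₂) (ι₂ : 𝓞 K₂ →+* End B₂) (θ₂ : K₂ →+* Module.End ℂ (complexBetti B₂.X 1)),
                IsCMTypeRealisation Φ₂ B₂ ι₂ θ₂ →
                  (¬ ∃ F : IntermediateField ℚ K₀, Module.finrank ℚ F = 2 ∧ IsTotallyComplex F ∧ Nonempty (F →+* K₂)) ∧ normalClosure ℚ K₂ ℂ ≠ normalClosure ℚ K₀ ℂ))
    (hT4 : ∀ B₀ B₁ B₂ B₃ : AbelianVariety ℂ, B₀.IsSimple → B₁.IsSimple → B₂.IsSimple → B₃.IsSimple →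
      AVDominatedBy B₀ X → AVDominatedBy B₁ X → AVDominatedBy B₂ X → AVDominatedBy B₃ X → B₀.dim = 3 → B₁.dim = 3 → B₂.dim = 3 → B₃.dim = 3 →
      ¬ IsIsogenous B₀ B₁ → ¬ IsIsogenous B₀ B₂ → ¬ IsIsogenous B₀ B₃ → ¬ IsIsogenous B₁ B₂ → ¬ IsIsogenous B₁ B₃ → ¬ IsIsogenous B₂ B₃ →
      ∀ (K₀ : Type) [Field K₀] [NumberField K₀] [IsCMField K₀] (Φ₀ : CMType K₀) (ι₀ : 𝓞 K₀ →+* End B₀) (θ₀ : K₀ →+* Module.End ℂ (complexBetti B₀.X 1))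
        (K₁ : Type) [Field K₁] [NumberField K₁] [IsCMField K₁] (Φ₁ : CMType K₁) (ι₁ : 𝓞 K₁ →+* End B₁) (θ₁ : K₁ →+* Module.End ℂ (complexBetti B₁.X 1))
        (K₂ : Type) [Field K₂] [NumberField K₂] [IsCMField K₂] (Φ₂ : CMType K₂) (ι₂ : 𝓞 K₂ →+* End B₂) (θ₂ : K₂ →+* Module.End ℂ (complexBetti B₂.X 1))
        (K₃ : Type) [Field K₃] [NumberField K₃] [IsCMField K₃] (Φ₃ : CMType K₃) (ι₃ : 𝓞 K₃ →+* End B₃) (θ₃ : K₃ →+* Module.End ℂ (complexBetti B₃.X 1)),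
        IsCMTypeRealisation Φ₀ B₀ ι₀ θ₀ → IsCMTypeRealisation Φ₁ B₁ ι₁ θ₁ → IsCMTypeRealisation Φ₂ B₂ ι₂ θ₂ → IsCMTypeRealisation Φ₃ B₃ ι₃ θ₃ →
          ¬ (Nonempty (K₁ ≃+* K₀) ∧ Nonempty (K₂ ≃+* K₀) ∧ Nonempty (K₃ ≃+* K₀)))
    (hS : ∀ B₀ B₁ B₂ : AbelianVariety ℂ, B₀.IsSimple → B₁.IsSimple → B₂.IsSimple → AVDominatedBy B₀ X → AVDominatedBy B₁ X → AVDominatedBy B₂ X →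
      B₀.dim = 2 → B₁.dim = 2 → B₂.dim = 2 → ¬ IsIsogenous B₀ B₁ → ¬ IsIsogenous B₀ B₂ → ¬ IsIsogenous B₁ B₂ →
      ∀ (K₀ : Type) [Field K₀] [NumberField K₀] [IsCMField K₀] (Φ₀ : CMType K₀) (ι₀ : 𝓞 K₀ →+* End B₀) (θ₀ : K₀ →+* Module.End ℂ (complexBetti B₀.X 1))
        (K₁ : Type) [Field K₁] [NumberField K₁] [IsCMField K₁] (Φ₁ : CMType K₁) (ι₁ : 𝓞 K₁ →+* End B₁) (θ₁ : K₁ →+* Module.End ℂ (complexBetti B₁.X 1))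
        (K₂ : Type) [Field K₂] [NumberField K₂] [IsCMField K₂] (Φ₂ : CMType K₂) (ι₂ : 𝓞 K₂ →+* End B₂) (θ₂ : K₂ →+* Module.End ℂ (complexBetti B₂.X 1)),
        IsCMTypeRealisation Φ₀ B₀ ι₀ θ₀ → IsCMTypeRealisation Φ₁ B₁ ι₁ θ₁ → IsCMTypeRealisation Φ₂ B₂ ι₂ θ₂ →
          ¬ (normalClosure ℚ K₀ ℂ = normalClosure ℚ K₁ ℂ ∧ normalClosure ℚ K₁ ℂ = normalClosure ℚ K₂ ℂ))
    {B : AbelianVariety ℂ} {N : ℕ} (hB : AVDominatedBy B (X.powSucc N)) : HodgeConjectureFor B.dim B.X := by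
  refine hodgeConjectureFor_of_avDominatedBy_powSucc_of_isOfCMType_of_twoPerIsolatedField_of_markman hW4 hcm h3 ?_ hT4 hS hB
  intro B₀ B₁ hs₀ hs₁ hd₀ hd₁ h3₀ h3₁ hni K₀ _ _ _ Φ₀ ι₀ θ₀ K₁ _ _ _ Φ₁ ι₁ θ₁ hA₀ hA₁ hsh
  obtain ⟨K₀', _, _, _, Φ₀', ι₀', θ₀', K₁', _, _, _, Φ₁', ι₁', θ₁', hA₀', hA₁', hQ⟩ := hT B₀ B₁ hs₀ hs₁ hd₀ hd₁ h3₀ h3₁ hni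
  obtain ⟨ε₀, -⟩ := exists_ringEquiv_forall_mem_iff_of_isIsogenous hA₀ hA₀' hs₀ (IsIsogenous.refl _)
  obtain ⟨ε₁, -⟩ := exists_ringEquiv_forall_mem_iff_of_isIsogenous hA₁ hA₁' hs₁ (IsIsogenous.refl _)
  rcases hQ (exists_quadratic_subfield_of_ringEquiv ε₀ ε₁ hsh) with hne | hisol
  · exact Or.inl ⟨fun e => hne.false (ε₁.symm.trans (e.trans ε₀))⟩
  · refine Or.inr fun B₂ hs₂ hd₂ h3₂ hn₀ hn₁ K₂ _ _ _ Φ₂ ι₂ θ₂ hA₂ => ?_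
    obtain ⟨hnsh, hL⟩ := hisol B₂ hs₂ hd₂ h3₂ hn₀ hn₁ K₂ Φ₂ ι₂ θ₂ hA₂
    refine ⟨fun h => hnsh (exists_quadratic_subfield_of_ringEquiv ε₀ (RingEquiv.refl K₂) h), ?_⟩
    rw [normalClosure_eq_of_ringEquiv ε₀]
    exact hL

end OnTheVariety

end Summit.HodgeConjecture.CorCM.MultiFieldWeil

end
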